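import Summits.QuantumFields.BalabanUV.T4Continuum.Support.DirichletCutoutFarPart
import Summits.QuantumFields.BalabanUV.T4Continuum.Support.DirichletCutoutNearLocal

/-!
# `BalabanUV.T4Continuum.Support.DirichletCutoutSplit` — NE2 (node U1a) formalisation swarm, sub-row `T4-U1a.S-NE2-D1-DIRICHLET°`, supplier item
# «Δ1-SKELETON» (file 13): THE SPLIT — for the `U = 1` scalar region Dirichlet solution `v` on an ARBITRARY union of unit blocks, the pure
# second differences along every axis are REDUCED to the local energy and mass of `v` on the explicit corner cut-out:
# `‖∂_μᴴ∂_μ v‖² ≤ 16n·A₁A₂·‖w‖² + 16n²·E_loc(v) + 16n⁴·ell1C²·M_loc(v)`, where `E_loc` ∕ `M_loc` are sums over the sites where `etaC` is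
# non-zero ∕ moves — all of which lie in the radius-`(R′+R+1)` bundles of the mixed codimension-3 cells (file 12)
# (unit b2b-balaban-t4-ne2-formalise-leaf-08, gen 7, file 13)

HONEST FRAMING.  Rung (B)+1 bookkeeping at MODEL level (U = 1 scalar `Δ′ = Δ + a′Π′`, finite torus); [folklore]; NE2 (U1a) is NOT proved by
this file; spine PROVED 0/9 unchanged; NOT infinite volume, NOT the mass gap, NOT Clay.  HONEST DEPENDENCY (verbatim): «continuum YM on T⁴ ⇐
BetaPertH ∧ nine spine estimates (0/9 proved); BetaPertH ⇐ (D1) ∧ (D4) ∧ CAP+tail; G-an2-4 gates asym, D1 and NE2/3/4.»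

WHAT THIS FILE PROVES (0 sorry; files 11, 12 BY NAME).  `Eloc` ∕ `Mloc` (data: the local energy ∕ mass of a field on the support ∕ transition set
of `etaC`), **`nsq_sdiffH_sdiff_near_le`** (`‖∂_μᴴ∂_μ(etaC·v)‖² ≤ 4n²(2·Eloc + 2n²·ell1C²·Mloc)`), and THE SPLIT **`nsq_sdiffH_sdiff_solExt_le_split`**.
WHAT REMAINS for the two-level law on every union of blocks (typed, for the next file): `Eloc(v) + n²·ell1C²·Mloc(v) ≤ C(d)·θ_d^J·(E(v) + Σ_Ω|Δv|²/…)`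
from gen 6's `morrey_decay_blockReg` at every bottom vertex of every `−μ`-exposed block (d = 3; `tube_decay_ramp` along mixed edges in
d = 4), with the bounded overlap (`≤ 3^d`) of the big cubes — then `J = k/4`, `R ≍ n·2^{−J}` give a geometric rate.

ABSOLUTE RULE (cell, verbatim): «No internally-minted statement may enter as a cited fact. Every hypothesis is either kernel-proved in
this package or a verbatim quotation of a PUBLISHED theorem with page reference. The manuscript(s) under audit are NOT citable for
their own disputed steps — they are the thing under adjudication; programme-internal (2001/route/tribunal) claims are never citable.»
[folklore]; two data definitions; no `def … : Prop` fact.  NOT CLAIMED: the decay of `Eloc`/`Mloc`, the two-level law; NE2; NE3.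
-/

noncomputable section

open scoped BigOperators ComplexConjugate Matrix
open Finset

namespace Summit.QuantumFields.BalabanUV.T4Continuum.DirichletCutoutSplit

open Literature.MathematicalPhysics.QuantumFieldTheory.Balaban1983to89.B5Prop11Plancherel (Tor fine unitVec)
open Literature.MathematicalPhysics.QuantumFieldTheory.Balaban1983to89.B5Action121 (sdiff LapS)
open Literature.MathematicalPhysics.QuantumFieldTheory.Balaban1983to89.B5Prop11Lower (nsq nsq_nonneg)
open Summit.QuantumFields.BalabanUV.Beta.GAN24.DirichletBoxTrace (blockReg)
open Summit.QuantumFields.BalabanUV.Beta.GAN24.DirichletBoxCompression (solExt)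
open Summit.QuantumFields.BalabanUV.T4Continuum.ScalarBlockPoincare (nsq_add_le)
open Summit.QuantumFields.BalabanUV.T4Continuum.DirichletDirectionalBesovCutoff (cut energy cut_add_cut_compl)
open Summit.QuantumFields.BalabanUV.T4Continuum.ScaleProfile (lip1 lip1_nonneg)
open Summit.QuantumFields.BalabanUV.T4Continuum.DirichletCornerCutoutEta (etaC etaC_mem etaC_step ell1C)
open Summit.QuantumFields.BalabanUV.T4Continuum.DirichletCutoutFarPart (A1 A2 nsq_sdiffH_sdiff_cutout_le)
open Summit.QuantumFields.BalabanUV.T4Continuum.DirichletCutoutNearLocal (nsq_sdiffH_sdiff_le_energy energy_cut_le_local)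

variable {d : ℕ} (n : ℕ) [NeZero n] (M : Fin d → ℕ) [hM : ∀ μ, NeZero (M μ)] (S : Tor M → Prop) [DecidablePred S] (μ : Fin d) (R R' : ℕ)

/-- the LOCAL ENERGY of a field on the bonds entering the support of `etaC`. [folklore] -/
def Eloc (z : Tor (fine n M) → ℂ) : ℝ :=
  ∑ ν : Fin d, ∑ x, (if etaC n M S μ R R' (x + unitVec (fine n M) ν) ≠ 0 then ‖(sdiff (fine n M) (n : ℂ) ν *ᵥ z) x‖ ^ 2 else 0)

/-- the LOCAL MASS of a field on the sites where `etaC` moves. [folklore] -/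
def Mloc (z : Tor (fine n M) → ℂ) : ℝ :=
  ∑ ν : Fin d, ∑ x, (if etaC n M S μ R R' (x + unitVec (fine n M) ν) ≠ etaC n M S μ R R' x then ‖z x‖ ^ 2 else 0)

section Split

variable {n M S μ R R'} (hR : 2 ≤ R) (hR' : 2 ≤ R') (hn : 2 * (R' + R) ≤ n)
include hR hR' hn

/-- **THE NEAR PART, reduced to local data**: `‖∂_μᴴ∂_μ(etaC·z)‖² ≤ 4n²·(2·Eloc z + 2n²·ell1C²·Mloc z)` for every field `z`. [folklore] -/
theorem nsq_sdiffH_sdiff_near_le (z : Tor (fine n M) → ℂ) :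
    nsq ((sdiff (fine n M) (n : ℂ) μ)ᴴ *ᵥ (sdiff (fine n M) (n : ℂ) μ *ᵥ cut (fine n M) (etaC n M S μ R R') z))
      ≤ 4 * (n : ℝ) ^ 2 * (2 * Eloc n M S μ R R' z + 2 * (n : ℝ) ^ 2 * ell1C d R ^ 2 * Mloc n M S μ R R' z) := by
  have h1 := nsq_sdiffH_sdiff_le_energy (fine n M) (n : ℂ) μ (cut (fine n M) (etaC n M S μ R R') z)
  have h2 := energy_cut_le_local (fine n M) (n : ℂ) (fun x => (etaC_mem hR hn (S := S) (μ := μ) (R' := R') x).1)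
    (fun x => (etaC_mem hR hn (S := S) (μ := μ) (R' := R') x).2) (fun x ν => etaC_step hR hR' hn (S := S) (μ := μ) (R' := R') ν x) z
  rw [Complex.norm_natCast] at h1 h2
  refine h1.trans ?_
  have : energy (fine n M) (n : ℂ) (cut (fine n M) (etaC n M S μ R R') z)
      ≤ 2 * Eloc n M S μ R R' z + 2 * (n : ℝ) ^ 2 * ell1C d R ^ 2 * Mloc n M S μ R R' z := by
    unfold Eloc Mloc; exact h2
  exact mul_le_mul_of_nonneg_left this (by positivity)

/-- **THE SPLIT**: for every axis `μ`, every block set `S`, `v = solExt n M a′ (blockReg S) w`: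
`‖∂_μᴴ∂_μ v‖² ≤ 2·(8n·A₁A₂·‖w‖²) + 2·4n²(2·Eloc v + 2n²·ell1C²·Mloc v)`. [folklore] -/
theorem nsq_sdiffH_sdiff_solExt_le_split (hn4 : 4 * R ≤ n) (hRR : 2 * R + 2 ≤ R') {a' : ℝ} (ha' : 0 < a')
    (w : {x // blockReg n M S x} → ℂ) :
    nsq ((sdiff (fine n M) (n : ℂ) μ)ᴴ *ᵥ (sdiff (fine n M) (n : ℂ) μ *ᵥ solExt n M a' (blockReg n M S) w))
      ≤ 2 * (8 * n * A1 d a' n R * A2 d a' n R * nsq w)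
        + 2 * (4 * (n : ℝ) ^ 2 * (2 * Eloc n M S μ R R' (solExt n M a' (blockReg n M S) w)
            + 2 * (n : ℝ) ^ 2 * ell1C d R ^ 2 * Mloc n M S μ R R' (solExt n M a' (blockReg n M S) w))) := by
  set v := solExt n M a' (blockReg n M S) w
  have hsplit : (sdiff (fine n M) (n : ℂ) μ)ᴴ *ᵥ (sdiff (fine n M) (n : ℂ) μ *ᵥ v)
      = (sdiff (fine n M) (n : ℂ) μ)ᴴ *ᵥ (sdiff (fine n M) (n : ℂ) μ *ᵥ cut (fine n M) (etaC n M S μ R R') v)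
        + (sdiff (fine n M) (n : ℂ) μ)ᴴ *ᵥ (sdiff (fine n M) (n : ℂ) μ *ᵥ cut (fine n M) (fun x => 1 - etaC n M S μ R R' x) v) := by
    rw [← Matrix.mulVec_add, ← Matrix.mulVec_add, cut_add_cut_compl]
  rw [hsplit]
  refine (nsq_add_le _ _).trans ?_
  have hN := nsq_sdiffH_sdiff_near_le hR hR' hn (S := S) (μ := μ) (R' := R') v
  have hF := nsq_sdiffH_sdiff_cutout_le hR hn4 hRR hn ha' (S := S) (R' := R') μ w
  linarith

end Split

end Summit.QuantumFields.BalabanUV.T4Continuum.DirichletCutoutSplit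

end
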